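import Summits.QuantumFields.YangMills.Theorems.UnitScaleTiltProp7LatticeBoxPoincareCov
import Summits.QuantumFields.YangMills.Theorems.UnitScaleTiltProp7SliceBoundBookkeeping
import Literature.MathematicalPhysics.QuantumFieldTheory.Balaban1983to89.B7Prop4Flat
import HarnessLib

/-!
# Route `UnitScaleTilt`, crux K1 «MinimiserStabilityRegPr» (stmt-QuantumFields-19200), LANE II (QB) ∕ (R-LEGS): GENERIC ℤᵈ LETTERS FOR THE CORNER-FRAME LEGS —
# the tree functional `F̂` is `ℓ²`-bounded by the box, and box means at two scales differ by `O(R⁻¹)·(gradient energy)` (d = 3 capacity scaling)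

Cell `ym3-torus`, width seat `ym3-torus-px19` (gen 6; pen (R-LEGS) per ★p1 g19 NAMER WORDS №6–№8; SIGNATURE-0 texts `SIGNATURE0-RLEGS-texts.px19g6.lean`, mechanism of record bus
2026-08-29 «nested means, no log»).  THEOREMS ONLY (0 `def`, 0 `sorry`); `--supports stmt-QuantumFields-19200 --as helper`, count-neutral.  YM₃ on T³ is a ladder rung (R3), not
d = 4, not the Clay problem; nothing here claims a stub, the crux or the gap.

THE POINT.  The flat linearised comb frame is `r₁X(ŷ) = Σ_{j<k} F̂(L^{k−j}ŷ)[Q_j(1)X♯]` (✓`Prop7FlatFrameResponse.fderiv_frameTw_one_apply`; lit `B7Prop3Flat.Fhat`,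
`B7Prop4Flat.linQIter`).  Its coarse gradient `r₁X(ŷ) − r₁X(ŷ + e_μ)` is, level by level, `F̂` applied to the DIFFERENCE of the cornered tube field `Q_j(1)X♯` and its translate by
`ℓ` fine units; each tube value is `Lʲ ×` an honest average of `X` over `L^{4j}` slots, so the difference is a difference of two MEANS of `X` at distance `ℓ`, controlled through a
chain of nested box means (3-d capacity: a box of side `a` costs `E∕a`).  This file supplies the three generic letters of that bookkeeping on `ℤᵈ`:
* §1 `norm_Fhat_le` ∕ `normSq_Fhat_le`: `‖F̂_L(A)(q)‖² ≤ (d·L)²·Σ_{x ∈ box(q, dL), κ} ‖A x κ‖²` (lit ✓`norm_asum_le`, `length_treeWord`, `l1_boxVec_le`); `Fhat_sub`.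
* §2 `normSq_boxMean_sub_boxMean_le`: for `box z R ⊆ box z′ R′`, `‖mean_{box z R} F − mean_{box z′ R′} F‖² ≤ N·R′(2R′+1)∕#box(z,R) · GradE(box z′ R′)` (Jensen + ★px4
  ✓`Prop7LatticeBoxPoincareCov.sum_sq_sub_mean_le_box_matrix`).
* §3 `normSq_avg_comp_sub_boxMean_le`: the same for ANY multiset average whose image lies in `box z′ R′` with fibre multiplicity `≤ μ` over `s.card` slots:
  `‖avg_s (F∘β) − mean_{box z′ R′} F‖² ≤ (μ∕#s)·N·R′(2R′+1)·GradE(box z′ R′)` (★px6 ✓`Prop7SliceBoundBookkeeping.norm_sq_avg_comp_le`).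
HONEST SCOPE.  Elementary lattice bookkeeping (Cauchy–Schwarz, Jensen, the box Poincaré inequality of record); no YM content.

References: T. Bałaban, CMP 98 (1985) 17–51 [Balaban1985Averaging] ((110)–(112) p.34, (122)–(127) pp.36–37, (160) p.42); M. Giaquinta, Multiple integrals in the
calculus of variations (1983) [Giaquinta1984] (Ch. III §1); T. Bałaban, CMP 89 (1983) 571–597 [Balaban1983RegularityDecay] ((2.27) p.580).
-/

set_option autoImplicit false

noncomputable section

open scoped BigOperators Matrix.Norms.L2Operator
open Finset

namespace Summit.QuantumFields.YangMills.Theorems.Prop7CornerTreeTubeLetters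

open Literature.MathematicalPhysics.QuantumFieldTheory.Balaban1983to89
open Literature.MathematicalPhysics.QuantumFieldTheory.Balaban1983to89.B4Eq19LatticeOperators (Zd box unitVec mem_box)
open B7Prop1Explicit (asum treeWord boxVec l1 norm_asum_le length_treeWord l1_boxVec_le)
open B7Prop3Flat (Fhat)
open B7Prop4Flat (asum_sub)
open Summit.QuantumFields.YangMills.Theorems.Prop7LatticeBoxPoincareCov (sum_sq_sub_mean_le_box_matrix)
open Summit.QuantumFields.YangMills.Theorems.Prop7SliceBoundBookkeeping (norm_sq_avg_comp_le norm_sq_sum_le_card_mul)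

variable {d N : ℕ}

/-! ## §1 The tree functional `F̂` is bounded by the box -/

/-- `l1 (x − q) ≤ R ⟹ x ∈ box q R`. [folklore] -/
theorem mem_box_of_l1_le {x q : Zd d} {R : ℕ} (h : l1 (x - q) ≤ R) : x ∈ box q R := by
  rw [mem_box]
  intro i
  have h1 : ((x - q) i).natAbs ≤ l1 (x - q) := by
    unfold l1
    exact Finset.single_le_sum (f := fun κ => ((x - q) κ).natAbs) (fun _ _ => Nat.zero_le _) (Finset.mem_univ i)
  have h2 : (((x - q) i).natAbs : ℤ) ≤ (R : ℤ) := by exact_mod_cast h1.trans h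
  rw [Pi.sub_apply, Int.natCast_natAbs] at h2
  exact h2

/-- **`‖F̂_L(A)(q)‖ ≤ d·L·√(Σ_{x∈box(q,dL),κ}‖A x κ‖²)`**: every tree contour from `q` into the block has length `≤ d·L` and stays in the box of radius `d·L`; lit ✓`norm_asum_le`.
[cite: Balaban1985Averaging, (110)–(112) p.34] -/
theorem norm_Fhat_le (L : ℕ) (hL : 1 ≤ L) (A : Zd d → Fin d → Matrix (Fin N) (Fin N) ℂ) (q : Zd d) :
    ‖Fhat L A q‖ ≤ (d * L : ℝ) * Real.sqrt (∑ x ∈ box q ((d * L : ℕ) : ℤ), ∑ κ : Fin d, ‖A x κ‖ ^ 2) := by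
  set S : ℝ := ∑ x ∈ box q ((d * L : ℕ) : ℤ), ∑ κ : Fin d, ‖A x κ‖ ^ 2 with hS
  have hS0 : 0 ≤ S := Finset.sum_nonneg fun _ _ => Finset.sum_nonneg fun _ _ => sq_nonneg _
  have ha : 0 ≤ Real.sqrt S := Real.sqrt_nonneg _
  -- pointwise control inside the `l1`-ball of radius `dL`
  have hA : ∀ (x : Zd d) (κ : Fin d), l1 (x - q) ≤ d * L → ‖A x κ‖ ≤ Real.sqrt S := by
    intro x κ hx
    have hmem : x ∈ box q ((d * L : ℕ) : ℤ) := mem_box_of_l1_le hx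
    have h1 : ‖A x κ‖ ^ 2 ≤ S := by
      have h2 : ‖A x κ‖ ^ 2 ≤ ∑ κ' : Fin d, ‖A x κ'‖ ^ 2 :=
        Finset.single_le_sum (f := fun κ' => ‖A x κ'‖ ^ 2) (fun _ _ => sq_nonneg _) (Finset.mem_univ κ)
      exact h2.trans (Finset.single_le_sum (f := fun x => ∑ κ' : Fin d, ‖A x κ'‖ ^ 2)
        (fun _ _ => Finset.sum_nonneg fun _ _ => sq_nonneg _) hmem)
    calc ‖A x κ‖ = Real.sqrt (‖A x κ‖ ^ 2) := (Real.sqrt_sq (norm_nonneg _)).symm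
      _ ≤ Real.sqrt S := Real.sqrt_le_sqrt h1
  -- each contour sum
  have hw : ∀ r : Fin d → Fin L, ‖asum A q (treeWord (boxVec L r))‖ ≤ (d * L : ℝ) * Real.sqrt S := by
    intro r
    have hlen : (treeWord (boxVec L r)).length ≤ d * L := by
      rw [length_treeWord]; exact l1_boxVec_le L r
    have h := norm_asum_le A q (d * L) ha hA (treeWord (boxVec L r)) q (by
      have : l1 (q - q) = 0 := by simp [l1]
      omega)
    refine h.trans ?_
    exact mul_le_mul_of_nonneg_right (by exact_mod_cast hlen) ha
  -- the `L^{-d}`-weighted average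
  unfold Fhat
  calc ‖∑ r : Fin d → Fin L, (((L : ℝ) ^ d)⁻¹) • asum A q (treeWord (boxVec L r))‖
      ≤ ∑ r : Fin d → Fin L, ‖(((L : ℝ) ^ d)⁻¹) • asum A q (treeWord (boxVec L r))‖ := norm_sum_le _ _
    _ ≤ ∑ _r : Fin d → Fin L, (((L : ℝ) ^ d)⁻¹) * ((d * L : ℝ) * Real.sqrt S) := by
        refine Finset.sum_le_sum fun r _ => ?_
        rw [norm_smul, norm_inv, norm_pow, Real.norm_natCast]
        exact mul_le_mul_of_nonneg_left (hw r) (by positivity)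
    _ = (d * L : ℝ) * Real.sqrt S := by
        rw [Finset.sum_const, Finset.card_univ, Fintype.card_fun, Fintype.card_fin, Fintype.card_fin, nsmul_eq_mul]
        have hL0 : (L : ℝ) ≠ 0 := by exact_mod_cast (by omega : L ≠ 0)
        push_cast
        field_simp

/-- **`‖F̂_L(A)(q)‖² ≤ (d·L)²·Σ_{x∈box(q,dL),κ}‖A x κ‖²`.** [cite: Balaban1985Averaging, (110)–(112) p.34] -/
theorem normSq_Fhat_le (L : ℕ) (hL : 1 ≤ L) (A : Zd d → Fin d → Matrix (Fin N) (Fin N) ℂ) (q : Zd d) :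
    ‖Fhat L A q‖ ^ 2 ≤ (d * L : ℝ) ^ 2 * ∑ x ∈ box q ((d * L : ℕ) : ℤ), ∑ κ : Fin d, ‖A x κ‖ ^ 2 := by
  have hS0 : 0 ≤ ∑ x ∈ box q ((d * L : ℕ) : ℤ), ∑ κ : Fin d, ‖A x κ‖ ^ 2 :=
    Finset.sum_nonneg fun _ _ => Finset.sum_nonneg fun _ _ => sq_nonneg _
  have h := norm_Fhat_le L hL A q
  have h0 : 0 ≤ (d * L : ℝ) * Real.sqrt (∑ x ∈ box q ((d * L : ℕ) : ℤ), ∑ κ : Fin d, ‖A x κ‖ ^ 2) := by positivity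
  calc ‖Fhat L A q‖ ^ 2 ≤ ((d * L : ℝ) * Real.sqrt (∑ x ∈ box q ((d * L : ℕ) : ℤ), ∑ κ : Fin d, ‖A x κ‖ ^ 2)) ^ 2 :=
        pow_le_pow_left₀ (norm_nonneg _) h 2
    _ = (d * L : ℝ) ^ 2 * ∑ x ∈ box q ((d * L : ℕ) : ℤ), ∑ κ : Fin d, ‖A x κ‖ ^ 2 := by
        rw [mul_pow, Real.sq_sqrt hS0]

/-- `F̂` is additive: `F̂(A)(q) − F̂(A′)(q) = F̂(A − A′)(q)` (lit ✓`asum_sub`). [cite: Balaban1985Averaging, (110) p.34] -/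
theorem Fhat_sub (L : ℕ) (A A' : Zd d → Fin d → Matrix (Fin N) (Fin N) ℂ) (q : Zd d) :
    Fhat L A q - Fhat L A' q = Fhat L (A - A') q := by
  unfold Fhat
  rw [← Finset.sum_sub_distrib]
  refine Finset.sum_congr rfl fun r _ => ?_
  rw [← smul_sub, asum_sub]

/-! ## §2 Box means at two scales -/

/-- **JENSEN + POINCARÉ**: for `box z R ⊆ box z′ R′` (`0 ≤ R`, `0 ≤ R′`),
`‖mean_{box z R} F − mean_{box z′ R′} F‖² ≤ (N·R′(2R′+1) ∕ #box(z,R)) · Σ_{y ∈ box z′ R′, μ, y+e_μ ∈ box} ‖F(y+e_μ) − F y‖²`.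
[cite: Giaquinta1984, Ch. III §1 Thm 1.2 p.70; Balaban1983RegularityDecay, (2.27) p.580] -/
theorem normSq_boxMean_sub_boxMean_le [NeZero N] {z z' : Zd d} {R R' : ℤ} (hR : 0 ≤ R) (hR' : 0 ≤ R') (hsub : box z R ⊆ box z' R')
    (F : Zd d → Matrix (Fin N) (Fin N) ℂ) :
    ‖(((box z R).card : ℝ) : ℂ)⁻¹ • ∑ x ∈ box z R, F x - (((box z' R').card : ℝ) : ℂ)⁻¹ • ∑ x ∈ box z' R', F x‖ ^ 2
      ≤ (N * ((R' : ℝ) * (2 * R' + 1)) / (box z R).card)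
          * ∑ y ∈ box z' R', ∑ μ, (if y + unitVec μ ∈ box z' R' then ‖F (y + unitVec μ) - F y‖ ^ 2 else 0) := by
  set m' : Matrix (Fin N) (Fin N) ℂ := (((box z' R').card : ℝ) : ℂ)⁻¹ • ∑ x ∈ box z' R', F x with hm'
  have hz : z ∈ box z R := by rw [mem_box]; intro i; simp [hR]
  have hcard : 0 < (box z R).card := Finset.card_pos.mpr ⟨z, hz⟩
  have hc : (0 : ℝ) < (box z R).card := by exact_mod_cast hcard
  -- Jensen: `mean_R F − m' = mean_R (F − m')`
  have hJ : (((box z R).card : ℝ) : ℂ)⁻¹ • ∑ x ∈ box z R, F x - m'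
      = (((box z R).card : ℝ)⁻¹) • ∑ x ∈ box z R, (F x - m') := by
    have e1 : (((box z R).card : ℝ)⁻¹) • ∑ x ∈ box z R, F x = (((box z R).card : ℝ) : ℂ)⁻¹ • ∑ x ∈ box z R, F x := by
      rw [RCLike.real_smul_eq_coe_smul (K := ℂ)]
      norm_cast
    have e2 : (((box z R).card : ℝ)⁻¹) • ∑ x ∈ box z R, (F x - m') = (((box z R).card : ℝ)⁻¹) • ∑ x ∈ box z R, F x - m' := by
      rw [Finset.sum_sub_distrib, Finset.sum_const, smul_sub, ← Nat.cast_smul_eq_nsmul ℝ, smul_smul, inv_mul_cancel₀ hc.ne', one_smul]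
    rw [e2, e1]
  rw [hJ]
  have h1 : ‖(((box z R).card : ℝ)⁻¹) • ∑ x ∈ box z R, (F x - m')‖ ^ 2
      ≤ (((box z R).card : ℝ)⁻¹) * ∑ x ∈ box z R, ‖F x - m'‖ ^ 2 := by
    rw [norm_smul, mul_pow, Real.norm_eq_abs, abs_of_pos (inv_pos.mpr hc)]
    have h := norm_sq_sum_le_card_mul (box z R) (fun x => F x - m')
    calc (((box z R).card : ℝ)⁻¹) ^ 2 * ‖∑ x ∈ box z R, (F x - m')‖ ^ 2
        ≤ (((box z R).card : ℝ)⁻¹) ^ 2 * (((box z R).card : ℝ) * ∑ x ∈ box z R, ‖F x - m'‖ ^ 2) :=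
          mul_le_mul_of_nonneg_left h (sq_nonneg _)
      _ = (((box z R).card : ℝ)⁻¹) * ∑ x ∈ box z R, ‖F x - m'‖ ^ 2 := by field_simp
  have h2 : ∑ x ∈ box z R, ‖F x - m'‖ ^ 2 ≤ ∑ x ∈ box z' R', ‖F x - m'‖ ^ 2 :=
    Finset.sum_le_sum_of_subset_of_nonneg hsub fun _ _ _ => sq_nonneg _
  have h3 := sum_sq_sub_mean_le_box_matrix (N := N) (z := z') hR' F
  rw [← hm'] at h3
  have h4 : (((box z R).card : ℝ)⁻¹) * ∑ x ∈ box z R, ‖F x - m'‖ ^ 2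
      ≤ (((box z R).card : ℝ)⁻¹) * (N * ((R' : ℝ) * (2 * R' + 1))
          * ∑ y ∈ box z' R', ∑ μ, (if y + unitVec μ ∈ box z' R' then ‖F (y + unitVec μ) - F y‖ ^ 2 else 0)) :=
    mul_le_mul_of_nonneg_left (h2.trans h3) (inv_nonneg.mpr hc.le)
  have h5 : (((box z R).card : ℝ)⁻¹) * (N * ((R' : ℝ) * (2 * R' + 1))
          * ∑ y ∈ box z' R', ∑ μ, (if y + unitVec μ ∈ box z' R' then ‖F (y + unitVec μ) - F y‖ ^ 2 else 0))
      = (N * ((R' : ℝ) * (2 * R' + 1)) / (box z R).card)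
          * ∑ y ∈ box z' R', ∑ μ, (if y + unitVec μ ∈ box z' R' then ‖F (y + unitVec μ) - F y‖ ^ 2 else 0) := by
    rw [div_eq_mul_inv]; ring
  exact h1.trans (h4.trans_eq h5)

/-! ## §3 A multiset average against a box mean -/

/-- **JENSEN WITH MULTIPLICITY + POINCARÉ**: an average over `s.card` slots `β i` whose image lies in `box z′ R′`, each point hit `≤ μ` times, differs from the box mean by
`‖avg_s(F∘β) − mean_{box} F‖² ≤ (μ ∕ #s)·N·R′(2R′+1)·GradE(box z′ R′)` (★px6 ✓`norm_sq_avg_comp_le`, ★px4 ✓`sum_sq_sub_mean_le_box_matrix`).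
[cite: Giaquinta1984, Ch. III §1 Thm 1.2 p.70; Balaban1985Averaging, (122) p.36] -/
theorem normSq_avg_comp_sub_boxMean_le [NeZero N] {ι : Type*} (s : Finset ι) (hs : 0 < s.card) (β : ι → Zd d)
    {z' : Zd d} {R' : ℤ} (hR' : 0 ≤ R') (himg : ∀ i ∈ s, β i ∈ box z' R') {μ : ℕ}
    (hμ : ∀ b ∈ s.image β, (s.filter (fun i => β i = b)).card ≤ μ) (F : Zd d → Matrix (Fin N) (Fin N) ℂ) :
    ‖((s.card : ℝ)⁻¹) • ∑ i ∈ s, F (β i) - (((box z' R').card : ℝ) : ℂ)⁻¹ • ∑ x ∈ box z' R', F x‖ ^ 2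
      ≤ ((μ : ℝ) / s.card) * (N * ((R' : ℝ) * (2 * R' + 1)))
          * ∑ y ∈ box z' R', ∑ ν, (if y + unitVec ν ∈ box z' R' then ‖F (y + unitVec ν) - F y‖ ^ 2 else 0) := by
  classical
  set m' : Matrix (Fin N) (Fin N) ℂ := (((box z' R').card : ℝ) : ℂ)⁻¹ • ∑ x ∈ box z' R', F x with hm'
  have hc : (0 : ℝ) < s.card := by exact_mod_cast hs
  have hJ : ((s.card : ℝ)⁻¹) • ∑ i ∈ s, F (β i) - m' = ((s.card : ℝ)⁻¹) • ∑ i ∈ s, (F (β i) - m') := by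
    rw [Finset.sum_sub_distrib, Finset.sum_const, smul_sub]
    congr 1
    rw [← Nat.cast_smul_eq_nsmul ℝ, smul_smul, inv_mul_cancel₀ hc.ne', one_smul]
  rw [hJ]
  have h1 := norm_sq_avg_comp_le s hs β (fun b => F b - m') hμ
  have h2 : ∑ b ∈ s.image β, ‖F b - m'‖ ^ 2 ≤ ∑ x ∈ box z' R', ‖F x - m'‖ ^ 2 :=
    Finset.sum_le_sum_of_subset_of_nonneg (fun b hb => by
      obtain ⟨i, hi, rfl⟩ := Finset.mem_image.mp hb; exact himg i hi) fun _ _ _ => sq_nonneg _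
  have h3 := sum_sq_sub_mean_le_box_matrix (N := N) (z := z') hR' F
  rw [← hm'] at h3
  have hk : 0 ≤ (μ : ℝ) / s.card := by positivity
  calc ‖((s.card : ℝ)⁻¹) • ∑ i ∈ s, (F (β i) - m')‖ ^ 2
      ≤ ((μ : ℝ) / s.card) * ∑ b ∈ s.image β, ‖F b - m'‖ ^ 2 := h1
    _ ≤ ((μ : ℝ) / s.card) * ((N * ((R' : ℝ) * (2 * R' + 1)))
          * ∑ y ∈ box z' R', ∑ ν, (if y + unitVec ν ∈ box z' R' then ‖F (y + unitVec ν) - F y‖ ^ 2 else 0)) :=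
        mul_le_mul_of_nonneg_left (h2.trans h3) hk
    _ = _ := by ring

end Summit.QuantumFields.YangMills.Theorems.Prop7CornerTreeTubeLetters

end
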